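/-
Copyright (c) 2026 the pub-hodgecm-mathlib formalisation cell (harness21).  Prover seat hodgecm-mathlib-K2E1-p08 (g4), Track B ∕ K2-LIT, h413 =
`stmt-HodgeConjecture-24833`, line `K2_E1_TraceFormulaBeta`, campaign «EIS-RANK-ONE» rung R2 «Godement»; DEAL «EIS-U3-GODEMENT» of the dealer K2E1-plan (g3)
2026-09-04T04:19:39Z ∕ ruling R-EIS-1 ∕ «=» 04:38:21Z, file (G′): the R-EIS-1 heads for `flatSectionU` and the `U(J₃)` ∕ `U(J₂)` ∕ CM instances of ★ (G).
-/
import Summits.HodgeConjecture.HodgeConjecture.Theorems.K2E1BorelEisensteinGodementU    -- ★ p857410 (this seat): Godement's criterion, hypothesis-first, any `N`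
import HarnessLib

/-!
# K2·E1 — `K2E1BorelEisensteinGodementU3`: ABSOLUTE CONVERGENCE OF THE BOREL EISENSTEIN SERIES `E(f_z)` OF `U(Φ₃)` (and `U(Φ₂)`) GIVEN THE SIEGEL-DOMAIN INTEGRAL E4,
# WITH THE LOCALLY UNIFORM MAJORANT — the R-EIS-1 heads (campaign EIS-RANK-ONE, rung R2)

Track B ∕ K2-LIT, crux h413 = `stmt-HodgeConjecture-24833`, route of record `HCCMUnconditional`; cell `hodgecm-mathlib`, squad K2, ENGINE E1.  Prover seat
`hodgecm-mathlib-K2E1-p08` (g4); DEAL «EIS-U3-GODEMENT» (K2E1-plan (g3) 04:19:39Z; ruling R-EIS-1 04:25:41Z: head «E5∕E4 → 2 < z.re → (φ bounded, left-`B(F)`-invariant) → ∀ g,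
Summable (q ↦ ‖flatSectionU φ z (q̃ g)‖)» + the LOCALLY UNIFORM MAJORANT in the shape the R4a kit ★ `K2E1EisensteinSeriesRegularity` consumes), file (G′).  THEOREMS ONLY (no
`def`, no `instance`, no notation, no named-fact hypothesis, no `sorry`); lane `--kind proof --supports stmt-HodgeConjecture-24833 --as helper` (count-neutral).

INPUT: ★ (G) `summable_borelHeight_rpow_of_siegelIntegral` ∕ `exists_nhds_summable_majorant_borelHeight_rpow` (any `N`, hypotheses: Iwasawa `hIw`, a height ceiling `hceil`,
the Siegel-domain integral **E4** := «∃ a `(B(𝔸) ⊓ G(F))`-covering weight `β'` on `G(𝔸)` with `∫⁻ 𝟙_{H ≤ C₀} H^τ β' dμ ≠ ∞` for every `C₀`», `μ` Haar on `G(𝔸)`, `τ ≥ 0`).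
* §1 COMPARISON (no measure theory): `norm_flatSectionU_le` (`‖f_z(x)‖ ≤ M·H(x)^{Re z}` for `‖φ‖ ≤ M`), `summable_norm_flatSectionU_of_summable`, `exists_majorant_flatSectionU_of_majorant`.
* §2 ANY `N` (hypothesis-first): **`summable_norm_flatSectionU_of_siegelIntegral`** — `hIw → hceil → 0 ≤ z.re → E4(z.re) → ‖φ‖ ≤ M → ∀ g, Summable (q ↦ ‖flatSectionU φ z (γ̃_q * g)‖)`
  (these are the norms of the terms of `eisensteinSeriesU (flatSectionU φ z) g`, ★ `eisensteinSeriesU_flatSectionU`), and **`exists_locallyUniform_majorant_flatSectionU_of_siegelIntegral`**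
  — THE R4a SHAPE VERBATIM `∀ g₀, ∃ U ∈ 𝓝 g₀, ∃ u, Summable u ∧ ∀ g ∈ U, ∀ q, ‖flatSectionU φ z (γ̃_q * g)‖ ≤ u q`.
* §3 `N = 3` ∕ `N = 2` over any CM-type pair `(F, E, c)` (ceiling discharged by ★ (G) §2 = ★ big cell; the topological instances of `G(𝔸)` discharged from ★ `UnitaryGroupOfFormAdelicTopology`):
  `summable_borelHeight_rpow_three ∕ _two_of_siegelIntegral` (Iwasawa still a hypothesis — ★ only at CM pairs).
* §4 **THE CM PAIR `(L⁺, L, c)`, `N = 3` — ALL STRUCTURAL HYPOTHESES DISCHARGED** (Iwasawa ★ `exists_mem_borelAdelic_mul_mem_standardMaximalCompactGL_cm_three`):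
  **`summable_borelHeight_rpow_cm_three_of_siegelIntegral`** (`E4(τ) → ∀ g, Summable (q ↦ H(γ̃_q g)^τ)`), **`summable_eisensteinSeriesU_flatSectionU_cm_three_of_siegelIntegral`**
  (`0 ≤ z.re → E4(z.re) → ‖φ‖ ≤ M → ∀ g, Summable (q ↦ ‖flatSectionU φ z (γ̃_q * g)‖)`), **`exists_locallyUniform_majorant_flatSectionU_cm_three`** (R4a shape) — on Mok's
  `quasiSplit L⁺ L c 3 = cmDatum L 3 J₃` (`rfl`), the currency of 5Res ∕ 12R3.  `2 < z.re` enters only through E4 (files (G2) E5 → E4, (G3) E5 for `τ > 2`).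
HONEST LABEL: HC_CM is proved only modulo the 7 printed citations (2 remaining named inputs: hLiu418 = `stmt-HodgeConjecture-24832`, h413 = `stmt-HodgeConjecture-24833`) until rung 0
closes; count-neutral helper, proves no printed statement, closes no socket.
References: [Godement1964] R. Godement, Sém. Bourbaki 257, §8 · [Garrett2018] P. Garrett, *Modern Analysis of Automorphic Forms by Example* (2018), §3.10 (proof of Cor. 3.10.2) ·
[MoeglinWaldspurger1995] C. Mœglin, J.-L. Waldspurger, *Spectral Decomposition and Eisenstein Series* (1995), II.1.5 Prop. · [Rogawski1990] J. D. Rogawski, *Automorphic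
Representations of Unitary Groups in Three Variables* (1990), §2.2.
-/

set_option autoImplicit false
-- the mandated namespace repeats the single-problem summit's segment (`HodgeConjecture.HodgeConjecture`)
set_option linter.dupNamespace false

noncomputable section

open MeasureTheory MeasureTheory.Measure Set Filter Topology MulAction NumberField IsDedekindDomain
open scoped ENNReal NNReal Pointwise MatrixGroups
open Literature.MeasureTheory.Group
open Literature.NumberTheory.Automorphic Literature.NumberTheory.Automorphic.UnitaryGroup
open Summit.HodgeConjecture.HodgeConjecture.Cruxes.H413.K2E1BorelEisensteinU
open Summit.HodgeConjecture.HodgeConjecture.Cruxes.H413.K2E1BorelEisensteinGodementU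

namespace Summit.HodgeConjecture.HodgeConjecture.Cruxes.H413.K2E1BorelEisensteinGodementU3

variable {F E : Type} [Field F] [NumberField F] [Field E] [NumberField E] [Algebra F E] {c : E ≃ₐ[F] E} {N : ℕ} [NeZero N]

/-! ## §1 Comparison: `‖f_z‖ ≤ M · H^{Re z}` -/

/-- `‖f_z(x)‖ ≤ M · H(x)^{Re z}` for `‖φ‖ ≤ M` (★ `norm_flatSectionU`). [cite: MoeglinWaldspurger1995, II.1.5] -/
theorem norm_flatSectionU_le {φ : (quasiSplit F E c N).Adelic → ℂ} {M : ℝ} (hφ : ∀ x, ‖φ x‖ ≤ M) (z : ℂ) (x : (quasiSplit F E c N).Adelic) :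
    ‖flatSectionU φ z x‖ ≤ M * ((borelHeight x : ℝ)) ^ z.re := by
  rw [norm_flatSectionU]
  exact mul_le_mul_of_nonneg_right (hφ x) (Real.rpow_nonneg (borelHeight x).coe_nonneg _)

/-- **Bounded `φ`: summability of `‖f_z(γ̃_q g)‖` from that of `H(γ̃_q g)^{Re z}`.** [cite: MoeglinWaldspurger1995, II.1.5] [cite: Garrett2018, §3.10] -/
theorem summable_norm_flatSectionU_of_summable {φ : (quasiSplit F E c N).Adelic → ℂ} {M : ℝ} (hφ : ∀ x, ‖φ x‖ ≤ M) {z : ℂ} {ι : Type*}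
    {y : ι → (quasiSplit F E c N).Adelic} (hs : Summable fun i => ((borelHeight (y i) : ℝ)) ^ z.re) :
    Summable fun i => ‖flatSectionU φ z (y i)‖ :=
  Summable.of_nonneg_of_le (fun _ => norm_nonneg _) (fun i => norm_flatSectionU_le hφ z (y i)) (hs.mul_left M)

/-- **Bounded `φ`: a (locally uniform) majorant of `H(γ̃_q g)^{Re z}` gives one of `‖f_z(γ̃_q g)‖`.** [cite: MoeglinWaldspurger1995, II.1.5] [cite: Garrett2018, §3.10] -/
theorem exists_majorant_flatSectionU_of_majorant {φ : (quasiSplit F E c N).Adelic → ℂ} {M : ℝ} (hφ : ∀ x, ‖φ x‖ ≤ M) {z : ℂ} {ι : Type*}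
    {U : Set (quasiSplit F E c N).Adelic} {y : ι → (quasiSplit F E c N).Adelic → (quasiSplit F E c N).Adelic}
    (hmaj : ∃ u : ι → ℝ, Summable u ∧ ∀ g ∈ U, ∀ i, ((borelHeight (y i g) : ℝ)) ^ z.re ≤ u i) :
    ∃ u : ι → ℝ, Summable u ∧ ∀ g ∈ U, ∀ i, ‖flatSectionU φ z (y i g)‖ ≤ u i := by
  obtain ⟨u, hu, hle⟩ := hmaj
  have hM : 0 ≤ M := (norm_nonneg _).trans (hφ 1)
  exact ⟨fun i => M * u i, hu.mul_left M, fun g hg i => (norm_flatSectionU_le hφ z _).trans (mul_le_mul_of_nonneg_left (hle g hg i) hM)⟩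

/-! ## §2 Any `N`, hypothesis-first: the R-EIS-1 heads -/

section AnyN

variable [MeasurableSpace (quasiSplit F E c N).Adelic] [BorelSpace (quasiSplit F E c N).Adelic]

/-- **ABSOLUTE CONVERGENCE OF `E(f_z)(g) = Σ_q φ(γ̃_q g) H(γ̃_q g)^z` (any `N`, hypothesis-first).**  Iwasawa `hIw`, ceiling `hceil`, `0 ≤ Re z`, E4 at `τ = Re z`, `‖φ‖ ≤ M` ⟹ for
every `g`, the norms of the terms of `eisensteinSeriesU (flatSectionU φ z) g` (★ `eisensteinSeriesU_flatSectionU`) are summable. [cite: Godement1964, §8] [cite: MoeglinWaldspurger1995, II.1.5]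
[cite: Garrett2018, §3.10 (Cor. 3.10.2)] -/
theorem summable_norm_flatSectionU_of_siegelIntegral [T2Space (quasiSplit F E c N).Adelic] [SecondCountableTopology (quasiSplit F E c N).Adelic]
    [LocallyCompactSpace (quasiSplit F E c N).Adelic] (μ : Measure (quasiSplit F E c N).Adelic) [μ.IsHaarMeasure]
    (hIw : ∀ g : (quasiSplit F E c N).Adelic, ∃ b ∈ borelAdelic F E c N, ∃ k : (quasiSplit F E c N).Adelic,
      adelicVal F E c N ((StdForm.antidiagonal N).over E) k ∈ standardMaximalCompactGL N E ∧ g = b * k)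
    (hceil : ∀ g : (quasiSplit F E c N).Adelic, ∃ C₀ : ℝ≥0, ∀ γ : ↥(unitaryGroupOfForm (c : E →+* E) ((StdForm.antidiagonal N).over E)),
      borelHeight ((quasiSplit F E c N).toAdelic γ * g) ≤ C₀)
    {z : ℂ} (hz : 0 ≤ z.re)
    (hE4 : ∃ β' : (quasiSplit F E c N).Adelic → ℝ≥0∞, IsCoveringWeight ↥(borelAdelic F E c N ⊓ (quasiSplit F E c N).arithmeticSubgroup) β' ∧
      ∀ C₀ : ℝ≥0, ∫⁻ y, {y | borelHeight y ≤ C₀}.indicator (fun y => ENNReal.ofReal ((borelHeight y : ℝ) ^ z.re)) y * β' y ∂μ ≠ ∞)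
    {φ : (quasiSplit F E c N).Adelic → ℂ} {M : ℝ} (hφ : ∀ x, ‖φ x‖ ≤ M) (g : (quasiSplit F E c N).Adelic) :
    Summable fun q : Quotient (orbitRel ↥(borelU (c : E →+* E) ((StdForm.antidiagonal N).over E)) ↥(unitaryGroupOfForm (c : E →+* E) ((StdForm.antidiagonal N).over E))) =>
      ‖flatSectionU φ z ((quasiSplit F E c N).toAdelic (Quotient.out q : ↥(unitaryGroupOfForm (c : E →+* E) ((StdForm.antidiagonal N).over E))) * g)‖ :=
  summable_norm_flatSectionU_of_summable hφ (summable_borelHeight_rpow_of_siegelIntegral μ hIw hceil hz hE4 g)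

/-- **THE LOCALLY UNIFORM MAJORANT (R4a shape, any `N`, hypothesis-first)**: `∀ g₀, ∃ U ∈ 𝓝 g₀, ∃ u summable, ∀ g ∈ U, ∀ q, ‖f_z(γ̃_q g)‖ ≤ u q` — what continuity in `g` and
holomorphy in `z` of `E(f_z)` consume (★ `K2E1EisensteinSeriesRegularity`). [cite: MoeglinWaldspurger1995, II.1.5] [cite: Garrett2018, §3.10 (Cor. 3.10.2)] -/
theorem exists_locallyUniform_majorant_flatSectionU_of_siegelIntegral [T2Space (quasiSplit F E c N).Adelic] [SecondCountableTopology (quasiSplit F E c N).Adelic]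
    [LocallyCompactSpace (quasiSplit F E c N).Adelic] (μ : Measure (quasiSplit F E c N).Adelic) [μ.IsHaarMeasure]
    (hIw : ∀ g : (quasiSplit F E c N).Adelic, ∃ b ∈ borelAdelic F E c N, ∃ k : (quasiSplit F E c N).Adelic,
      adelicVal F E c N ((StdForm.antidiagonal N).over E) k ∈ standardMaximalCompactGL N E ∧ g = b * k)
    (hceil : ∀ g : (quasiSplit F E c N).Adelic, ∃ C₀ : ℝ≥0, ∀ γ : ↥(unitaryGroupOfForm (c : E →+* E) ((StdForm.antidiagonal N).over E)),
      borelHeight ((quasiSplit F E c N).toAdelic γ * g) ≤ C₀)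
    {z : ℂ} (hz : 0 ≤ z.re)
    (hE4 : ∃ β' : (quasiSplit F E c N).Adelic → ℝ≥0∞, IsCoveringWeight ↥(borelAdelic F E c N ⊓ (quasiSplit F E c N).arithmeticSubgroup) β' ∧
      ∀ C₀ : ℝ≥0, ∫⁻ y, {y | borelHeight y ≤ C₀}.indicator (fun y => ENNReal.ofReal ((borelHeight y : ℝ) ^ z.re)) y * β' y ∂μ ≠ ∞)
    {φ : (quasiSplit F E c N).Adelic → ℂ} {M : ℝ} (hφ : ∀ x, ‖φ x‖ ≤ M) (g₀ : (quasiSplit F E c N).Adelic) :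
    ∃ U ∈ 𝓝 g₀, ∃ u : Quotient (orbitRel ↥(borelU (c : E →+* E) ((StdForm.antidiagonal N).over E)) ↥(unitaryGroupOfForm (c : E →+* E) ((StdForm.antidiagonal N).over E))) → ℝ,
      Summable u ∧ ∀ g ∈ U, ∀ q,
        ‖flatSectionU φ z ((quasiSplit F E c N).toAdelic (Quotient.out q : ↥(unitaryGroupOfForm (c : E →+* E) ((StdForm.antidiagonal N).over E))) * g)‖ ≤ u q := by
  obtain ⟨U, hU, hmaj⟩ := exists_nhds_summable_majorant_borelHeight_rpow μ hIw hceil hz hE4 g₀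
  exact ⟨U, hU, exists_majorant_flatSectionU_of_majorant hφ
    (y := fun q g => (quasiSplit F E c N).toAdelic (Quotient.out q : ↥(unitaryGroupOfForm (c : E →+* E) ((StdForm.antidiagonal N).over E))) * g) hmaj⟩

end AnyN

/-! ## §3 `N = 3` and `N = 2`: the ceiling and the topology of `G(𝔸)` discharged -/

section Three

variable [MeasurableSpace (quasiSplit F E c 3).Adelic] [BorelSpace (quasiSplit F E c 3).Adelic]

/-- **`U(J₃)`, any CM-type pair `(F, E, c)`**: Iwasawa + E4(`τ`) ⟹ `∀ g, Summable (q ↦ H(γ̃_q g)^τ)` (ceiling ★ (G) `borelHeight_toAdelic_mul_le_max_three`; `G(𝔸)` Hausdorff, second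
countable, locally compact from ★ `UnitaryGroupOfFormAdelicTopology`). [cite: Godement1964, §8] [cite: Garrett2018, §3.10 (Cor. 3.10.2)] [cite: Rogawski1990, §2.2] -/
theorem summable_borelHeight_rpow_three_of_siegelIntegral (μ : Measure (quasiSplit F E c 3).Adelic) [μ.IsHaarMeasure]
    (hIw : ∀ g : (quasiSplit F E c 3).Adelic, ∃ b ∈ borelAdelic F E c 3, ∃ k : (quasiSplit F E c 3).Adelic,
      adelicVal F E c 3 ((StdForm.antidiagonal 3).over E) k ∈ standardMaximalCompactGL 3 E ∧ g = b * k)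
    {τ : ℝ} (hτ : 0 ≤ τ)
    (hE4 : ∃ β' : (quasiSplit F E c 3).Adelic → ℝ≥0∞, IsCoveringWeight ↥(borelAdelic F E c 3 ⊓ (quasiSplit F E c 3).arithmeticSubgroup) β' ∧
      ∀ C₀ : ℝ≥0, ∫⁻ y, {y | borelHeight y ≤ C₀}.indicator (fun y => ENNReal.ofReal ((borelHeight y : ℝ) ^ τ)) y * β' y ∂μ ≠ ∞) :
    ∀ g : (quasiSplit F E c 3).Adelic,
      Summable fun q : Quotient (orbitRel ↥(borelU (c : E →+* E) ((StdForm.antidiagonal 3).over E)) ↥(unitaryGroupOfForm (c : E →+* E) ((StdForm.antidiagonal 3).over E))) =>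
        ((borelHeight ((quasiSplit F E c 3).toAdelic (Quotient.out q : ↥(unitaryGroupOfForm (c : E →+* E) ((StdForm.antidiagonal 3).over E))) * g) : ℝ)) ^ τ := by
  haveI : T2Space (quasiSplit F E c 3).Adelic := inferInstanceAs (T2Space (adelic F E c 3 ((StdForm.antidiagonal 3).over E)))
  haveI : SecondCountableTopology (quasiSplit F E c 3).Adelic := inferInstanceAs (SecondCountableTopology (adelic F E c 3 ((StdForm.antidiagonal 3).over E)))
  haveI : LocallyCompactSpace (quasiSplit F E c 3).Adelic := inferInstanceAs (LocallyCompactSpace (adelic F E c 3 ((StdForm.antidiagonal 3).over E)))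
  exact summable_borelHeight_rpow_of_siegelIntegral μ hIw (fun g => ⟨_, fun γ => borelHeight_toAdelic_mul_le_max_three γ g⟩) hτ hE4

/-- **`U(J₃)`: the locally uniform majorant** (R4a shape on heights). [cite: Godement1964, §8] [cite: Garrett2018, §3.10 (Cor. 3.10.2)] -/
theorem exists_nhds_summable_majorant_borelHeight_rpow_three (μ : Measure (quasiSplit F E c 3).Adelic) [μ.IsHaarMeasure]
    (hIw : ∀ g : (quasiSplit F E c 3).Adelic, ∃ b ∈ borelAdelic F E c 3, ∃ k : (quasiSplit F E c 3).Adelic,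
      adelicVal F E c 3 ((StdForm.antidiagonal 3).over E) k ∈ standardMaximalCompactGL 3 E ∧ g = b * k)
    {τ : ℝ} (hτ : 0 ≤ τ)
    (hE4 : ∃ β' : (quasiSplit F E c 3).Adelic → ℝ≥0∞, IsCoveringWeight ↥(borelAdelic F E c 3 ⊓ (quasiSplit F E c 3).arithmeticSubgroup) β' ∧
      ∀ C₀ : ℝ≥0, ∫⁻ y, {y | borelHeight y ≤ C₀}.indicator (fun y => ENNReal.ofReal ((borelHeight y : ℝ) ^ τ)) y * β' y ∂μ ≠ ∞)
    (g₀ : (quasiSplit F E c 3).Adelic) :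
    ∃ U ∈ 𝓝 g₀, ∃ u : Quotient (orbitRel ↥(borelU (c : E →+* E) ((StdForm.antidiagonal 3).over E)) ↥(unitaryGroupOfForm (c : E →+* E) ((StdForm.antidiagonal 3).over E))) → ℝ,
      Summable u ∧ ∀ g ∈ U, ∀ q,
        ((borelHeight ((quasiSplit F E c 3).toAdelic (Quotient.out q : ↥(unitaryGroupOfForm (c : E →+* E) ((StdForm.antidiagonal 3).over E))) * g) : ℝ)) ^ τ ≤ u q := by
  haveI : T2Space (quasiSplit F E c 3).Adelic := inferInstanceAs (T2Space (adelic F E c 3 ((StdForm.antidiagonal 3).over E)))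
  haveI : SecondCountableTopology (quasiSplit F E c 3).Adelic := inferInstanceAs (SecondCountableTopology (adelic F E c 3 ((StdForm.antidiagonal 3).over E)))
  haveI : LocallyCompactSpace (quasiSplit F E c 3).Adelic := inferInstanceAs (LocallyCompactSpace (adelic F E c 3 ((StdForm.antidiagonal 3).over E)))
  exact exists_nhds_summable_majorant_borelHeight_rpow μ hIw (fun g => ⟨_, fun γ => borelHeight_toAdelic_mul_le_max_three γ g⟩) hτ hE4 g₀

end Three

section Two

variable [MeasurableSpace (quasiSplit F E c 2).Adelic] [BorelSpace (quasiSplit F E c 2).Adelic]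

/-- **`U(J₂)`, any CM-type pair** (ceiling ★ (G) `borelHeight_toAdelic_mul_le_max_two`): Iwasawa + E4(`τ`) ⟹ `∀ g, Summable (q ↦ H(γ̃_q g)^τ)` — a second, transport-free road to
Godement at `N = 2` next to ★ p857351. [cite: Godement1964, §8] [cite: Garrett2018, §2.8] -/
theorem summable_borelHeight_rpow_two_of_siegelIntegral (μ : Measure (quasiSplit F E c 2).Adelic) [μ.IsHaarMeasure]
    (hIw : ∀ g : (quasiSplit F E c 2).Adelic, ∃ b ∈ borelAdelic F E c 2, ∃ k : (quasiSplit F E c 2).Adelic,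
      adelicVal F E c 2 ((StdForm.antidiagonal 2).over E) k ∈ standardMaximalCompactGL 2 E ∧ g = b * k)
    {τ : ℝ} (hτ : 0 ≤ τ)
    (hE4 : ∃ β' : (quasiSplit F E c 2).Adelic → ℝ≥0∞, IsCoveringWeight ↥(borelAdelic F E c 2 ⊓ (quasiSplit F E c 2).arithmeticSubgroup) β' ∧
      ∀ C₀ : ℝ≥0, ∫⁻ y, {y | borelHeight y ≤ C₀}.indicator (fun y => ENNReal.ofReal ((borelHeight y : ℝ) ^ τ)) y * β' y ∂μ ≠ ∞) :
    ∀ g : (quasiSplit F E c 2).Adelic,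
      Summable fun q : Quotient (orbitRel ↥(borelU (c : E →+* E) ((StdForm.antidiagonal 2).over E)) ↥(unitaryGroupOfForm (c : E →+* E) ((StdForm.antidiagonal 2).over E))) =>
        ((borelHeight ((quasiSplit F E c 2).toAdelic (Quotient.out q : ↥(unitaryGroupOfForm (c : E →+* E) ((StdForm.antidiagonal 2).over E))) * g) : ℝ)) ^ τ := by
  haveI : T2Space (quasiSplit F E c 2).Adelic := inferInstanceAs (T2Space (adelic F E c 2 ((StdForm.antidiagonal 2).over E)))
  haveI : SecondCountableTopology (quasiSplit F E c 2).Adelic := inferInstanceAs (SecondCountableTopology (adelic F E c 2 ((StdForm.antidiagonal 2).over E)))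
  haveI : LocallyCompactSpace (quasiSplit F E c 2).Adelic := inferInstanceAs (LocallyCompactSpace (adelic F E c 2 ((StdForm.antidiagonal 2).over E)))
  exact summable_borelHeight_rpow_of_siegelIntegral μ hIw (fun g => ⟨_, fun γ => borelHeight_toAdelic_mul_le_max_two γ g⟩) hτ hE4

end Two

/-! ## §4 The CM pair `(L⁺, L, c)`, `N = 3`: everything structural discharged — the currency of 5Res ∕ 12R3 -/

section CM

variable (L : Type) [Field L] [NumberField L] [IsCMField L]
  [MeasurableSpace (quasiSplit (↥(maximalRealSubfield L)) L (IsCMField.complexConj L) 3).Adelic]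
  [BorelSpace (quasiSplit (↥(maximalRealSubfield L)) L (IsCMField.complexConj L) 3).Adelic]

/-- **GODEMENT FOR `U(Φ₃)` OVER A CM FIELD, GIVEN E4**: for a Haar measure `μ` on `U(J₃)(𝔸_{L⁺})`, `τ ≥ 0` and E4(`τ`), `Σ_{q ∈ B(L⁺)∖U(J₃)(L⁺)} H(γ̃_q g)^τ < ∞` for every `g` (Iwasawa ★
`exists_mem_borelAdelic_mul_mem_standardMaximalCompactGL_cm_three`). [cite: Godement1964, §8] [cite: MoeglinWaldspurger1995, II.1.5] [cite: Rogawski1990, §2.2] -/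
theorem summable_borelHeight_rpow_cm_three_of_siegelIntegral (μ : Measure (quasiSplit (↥(maximalRealSubfield L)) L (IsCMField.complexConj L) 3).Adelic) [μ.IsHaarMeasure]
    {τ : ℝ} (hτ : 0 ≤ τ)
    (hE4 : ∃ β' : (quasiSplit (↥(maximalRealSubfield L)) L (IsCMField.complexConj L) 3).Adelic → ℝ≥0∞,
      IsCoveringWeight ↥(borelAdelic (↥(maximalRealSubfield L)) L (IsCMField.complexConj L) 3 ⊓
        (quasiSplit (↥(maximalRealSubfield L)) L (IsCMField.complexConj L) 3).arithmeticSubgroup) β' ∧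
      ∀ C₀ : ℝ≥0, ∫⁻ y, {y | borelHeight y ≤ C₀}.indicator (fun y => ENNReal.ofReal ((borelHeight y : ℝ) ^ τ)) y * β' y ∂μ ≠ ∞) :
    ∀ g : (quasiSplit (↥(maximalRealSubfield L)) L (IsCMField.complexConj L) 3).Adelic,
      Summable fun q : Quotient (orbitRel ↥(borelU ((IsCMField.complexConj L : L ≃ₐ[↥(maximalRealSubfield L)] L) : L →+* L) ((StdForm.antidiagonal 3).over L))
          ↥(unitaryGroupOfForm ((IsCMField.complexConj L : L ≃ₐ[↥(maximalRealSubfield L)] L) : L →+* L) ((StdForm.antidiagonal 3).over L))) =>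
        ((borelHeight ((quasiSplit (↥(maximalRealSubfield L)) L (IsCMField.complexConj L) 3).toAdelic
          (Quotient.out q : ↥(unitaryGroupOfForm ((IsCMField.complexConj L : L ≃ₐ[↥(maximalRealSubfield L)] L) : L →+* L) ((StdForm.antidiagonal 3).over L))) * g) : ℝ)) ^ τ :=
  summable_borelHeight_rpow_three_of_siegelIntegral μ (exists_mem_borelAdelic_mul_mem_standardMaximalCompactGL_cm_three L) hτ hE4

/-- **THE R-EIS-1 HEAD AT THE CM PAIR: ABSOLUTE CONVERGENCE OF THE BOREL EISENSTEIN SERIES `E(f_z)` OF `U(Φ₃)` GIVEN E4** — `0 ≤ Re z`, E4(`Re z`), `‖φ‖ ≤ M` ⟹ `∀ g,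
Summable (q ↦ ‖flatSectionU φ z (γ̃_q g)‖)` (the norms of the terms of `eisensteinSeriesU (flatSectionU φ z) g`).  Godement's half-plane `2 < Re z` (`Re s > 1`) is where E4 holds
(files (G2), (G3)). [cite: Godement1964, §8] [cite: MoeglinWaldspurger1995, II.1.5] [cite: Garrett2018, §3.10 (Cor. 3.10.2)] [cite: Rogawski1990, §2.2] -/
theorem summable_eisensteinSeriesU_flatSectionU_cm_three_of_siegelIntegral
    (μ : Measure (quasiSplit (↥(maximalRealSubfield L)) L (IsCMField.complexConj L) 3).Adelic) [μ.IsHaarMeasure] {z : ℂ} (hz : 0 ≤ z.re)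
    (hE4 : ∃ β' : (quasiSplit (↥(maximalRealSubfield L)) L (IsCMField.complexConj L) 3).Adelic → ℝ≥0∞,
      IsCoveringWeight ↥(borelAdelic (↥(maximalRealSubfield L)) L (IsCMField.complexConj L) 3 ⊓
        (quasiSplit (↥(maximalRealSubfield L)) L (IsCMField.complexConj L) 3).arithmeticSubgroup) β' ∧
      ∀ C₀ : ℝ≥0, ∫⁻ y, {y | borelHeight y ≤ C₀}.indicator (fun y => ENNReal.ofReal ((borelHeight y : ℝ) ^ z.re)) y * β' y ∂μ ≠ ∞)
    {φ : (quasiSplit (↥(maximalRealSubfield L)) L (IsCMField.complexConj L) 3).Adelic → ℂ} {M : ℝ} (hφ : ∀ x, ‖φ x‖ ≤ M)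
    (g : (quasiSplit (↥(maximalRealSubfield L)) L (IsCMField.complexConj L) 3).Adelic) :
    Summable fun q : Quotient (orbitRel ↥(borelU ((IsCMField.complexConj L : L ≃ₐ[↥(maximalRealSubfield L)] L) : L →+* L) ((StdForm.antidiagonal 3).over L))
        ↥(unitaryGroupOfForm ((IsCMField.complexConj L : L ≃ₐ[↥(maximalRealSubfield L)] L) : L →+* L) ((StdForm.antidiagonal 3).over L))) =>
      ‖flatSectionU φ z ((quasiSplit (↥(maximalRealSubfield L)) L (IsCMField.complexConj L) 3).toAdelic
          (Quotient.out q : ↥(unitaryGroupOfForm ((IsCMField.complexConj L : L ≃ₐ[↥(maximalRealSubfield L)] L) : L →+* L) ((StdForm.antidiagonal 3).over L))) * g)‖ :=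
  summable_norm_flatSectionU_of_summable hφ (summable_borelHeight_rpow_cm_three_of_siegelIntegral L μ hz hE4 g)

/-- **THE LOCALLY UNIFORM MAJORANT AT THE CM PAIR (R4a shape verbatim)**: `∀ g₀, ∃ U ∈ 𝓝 g₀, ∃ u, Summable u ∧ ∀ g ∈ U, ∀ q, ‖flatSectionU φ z (γ̃_q * g)‖ ≤ u q`.
[cite: MoeglinWaldspurger1995, II.1.5] [cite: Garrett2018, §3.10 (Cor. 3.10.2)] -/
theorem exists_locallyUniform_majorant_flatSectionU_cm_three
    (μ : Measure (quasiSplit (↥(maximalRealSubfield L)) L (IsCMField.complexConj L) 3).Adelic) [μ.IsHaarMeasure] {z : ℂ} (hz : 0 ≤ z.re)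
    (hE4 : ∃ β' : (quasiSplit (↥(maximalRealSubfield L)) L (IsCMField.complexConj L) 3).Adelic → ℝ≥0∞,
      IsCoveringWeight ↥(borelAdelic (↥(maximalRealSubfield L)) L (IsCMField.complexConj L) 3 ⊓
        (quasiSplit (↥(maximalRealSubfield L)) L (IsCMField.complexConj L) 3).arithmeticSubgroup) β' ∧
      ∀ C₀ : ℝ≥0, ∫⁻ y, {y | borelHeight y ≤ C₀}.indicator (fun y => ENNReal.ofReal ((borelHeight y : ℝ) ^ z.re)) y * β' y ∂μ ≠ ∞)
    {φ : (quasiSplit (↥(maximalRealSubfield L)) L (IsCMField.complexConj L) 3).Adelic → ℂ} {M : ℝ} (hφ : ∀ x, ‖φ x‖ ≤ M)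
    (g₀ : (quasiSplit (↥(maximalRealSubfield L)) L (IsCMField.complexConj L) 3).Adelic) :
    ∃ U ∈ 𝓝 g₀, ∃ u : Quotient (orbitRel ↥(borelU ((IsCMField.complexConj L : L ≃ₐ[↥(maximalRealSubfield L)] L) : L →+* L) ((StdForm.antidiagonal 3).over L))
        ↥(unitaryGroupOfForm ((IsCMField.complexConj L : L ≃ₐ[↥(maximalRealSubfield L)] L) : L →+* L) ((StdForm.antidiagonal 3).over L))) → ℝ,
      Summable u ∧ ∀ g ∈ U, ∀ q,
        ‖flatSectionU φ z ((quasiSplit (↥(maximalRealSubfield L)) L (IsCMField.complexConj L) 3).toAdelic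
          (Quotient.out q : ↥(unitaryGroupOfForm ((IsCMField.complexConj L : L ≃ₐ[↥(maximalRealSubfield L)] L) : L →+* L) ((StdForm.antidiagonal 3).over L))) * g)‖ ≤ u q := by
  obtain ⟨U, hU, hmaj⟩ := exists_nhds_summable_majorant_borelHeight_rpow_three μ (exists_mem_borelAdelic_mul_mem_standardMaximalCompactGL_cm_three L) hz hE4 g₀
  exact ⟨U, hU, exists_majorant_flatSectionU_of_majorant hφ
    (y := fun q g => (quasiSplit (↥(maximalRealSubfield L)) L (IsCMField.complexConj L) 3).toAdelic
      (Quotient.out q : ↥(unitaryGroupOfForm ((IsCMField.complexConj L : L ≃ₐ[↥(maximalRealSubfield L)] L) : L →+* L) ((StdForm.antidiagonal 3).over L))) * g) hmaj⟩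

end CM

end Summit.HodgeConjecture.HodgeConjecture.Cruxes.H413.K2E1BorelEisensteinGodementU3

end
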